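import Summits.ValiantsHypothesis.ValiantsHypothesis.Theorems.EquivariantDialNotchTransfer
import Literature.Computability.AlgebraicComplexity.PermanentIrreducible
import Literature.Computability.AlgebraicComplexity.ApolarityFischerPairing
import HarnessLib

/-!
# The parity cut: `C(m, d)` generators for a row-flip- and row-permutation-stable cut of `per_m`

Support file of the decomposition workshop (lens 1, g31, OFFER O-L1-24; helper of `CollapseToVPws`):
pure algebra; INSTRUMENT; 0 S-currency; closes NO item.  No representation, no torus, no pencil; VP ≠ VNP,
`DcPerSuperpolynomial`, MS untouched.

★ `choose_le_card_of_stable`.  Let `s` be a finite set of forms of degree `d` in the `m²` variables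
`x_{(i,j)}` such that the linear span `V` of `s` is stable under the `m` ROW SIGN FLIPS
`x_{(i,j)} ↦ -x_{(i,j)}` (`rowFlip m i`) and under the ROW PERMUTATIONS `x_{(i,j)} ↦ x_{(σ i, j)}`, and such
that `per_m ∈ (s)`.  Then `C(m, d) ≤ |s|`.

Proof.  (1) `exists_rowCount_le_one`: some `p ∈ s` has a monomial `μ` taking at most one variable from
each row — otherwise every generator, hence the ideal `(s) ∋ per_m`, lies in the monomial ideal spanned by
the monomials with some row degree `≥ 2`, which contains no permutation monomial
(`mem_ideal_span_monomial_image`, `rowCount_permMonomial`).  (2) `card_filter_rowCount_eq_one`: the rows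
met by `μ` form a `d`-set `S₀`.  (3) `paritySlice_mem_span`: the PARITY SLICES `Q_{R,S}` (keep the monomials
whose row degree is odd exactly on `S`, among the rows of `R`) preserve `V`, because
`Q_{R ∪ {i}, S} = ½ (Q_{R,S} ∓ flip_i ∘ Q_{R,S})` (`paritySlice_insert`; the flip of row `i` multiplies
`coeff μ` by `(-1)^{rowdeg_i μ}`, `coeff_linSubst_rowFlip`) — these are the isotypic projectors of the
characters of `(ℤ/2)^m`.  (4) `paritySlice_rename`: the row permutation `σ` carries the full slice of
class `S` to the one of class `σ S`; `𝔖_m` is transitive on `d`-subsets (`exists_perm_map_eq`).  (5) Hence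
`V` contains a non-zero vector in each of the `C(m, d)` full parity classes `|S| = d`; their supports are
disjoint, so they are independent (`linearIndependent_of_paritySlice`) and `C(m, d) ≤ dim V ≤ |s|`.

References: Landsberg–Ressayre, *Permanent v. determinant: an exponential lower bound assuming symmetry
and a potential path towards Valiant's conjecture* (Differential Geom. Appl. 55 (2017)), Thm 2.8 / §4
[cite: LandsbergRessayre2017, Thm 2.8] — there the count `2^m - 1 = Σ_d C(m,d)` comes from the weights
of the left TORUS; here the `d`-th summand is obtained from the 2-torsion of the torus alone.
-/

set_option linter.dupNamespace false

noncomputable section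

namespace Summit.ValiantsHypothesis.ValiantsHypothesis.Theorems.EquivariantDialParityCut

open MvPolynomial Matrix Literature.Computability.AlgebraicComplexity

/-! ## The row sign flips and their action on coefficients -/

/-- The sign flip of row `i`: the diagonal substitution matrix `x_{(i,j)} ↦ -x_{(i,j)}` (all `j`), identity on
the other rows. [cite: LandsbergRessayre2017, Thm 2.8] -/
def rowFlip (m : ℕ) (i : Fin m) : Matrix (Fin m × Fin m) (Fin m × Fin m) ℂ :=
  Matrix.diagonal fun v => if v.1 = i then -1 else 1

variable {m : ℕ}

/-- The row flip acts on coefficients by the parity character `(-1)^{rowdeg_i}`. [folklore] -/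
theorem coeff_linSubst_rowFlip (i : Fin m) (f : MvPolynomial (Fin m × Fin m) ℂ) (μ : Fin m × Fin m →₀ ℕ) :
    coeff μ (linSubst (Fin m × Fin m) ℂ (rowFlip m i) f) = (-1) ^ rowCount μ i * coeff μ f := by
  have h0 : ∀ v ∈ (Finset.univ : Finset (Fin m × Fin m)), v ∉ μ.support →
      (if v.1 = i then μ v else 0) = 0 := fun v _ hv => by
    rw [Finsupp.notMem_support_iff.1 hv]
    split_ifs <;> rfl
  have hsum : (∑ v ∈ μ.support, if v.1 = i then μ v else 0) = rowCount μ i := by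
    rw [Finset.sum_subset (Finset.subset_univ μ.support) h0]
    unfold rowCount
    rw [Fintype.sum_prod_type, Finset.sum_comm]
    simp
  have hprod : (∏ v ∈ μ.support, (if v.1 = i then (-1 : ℂ) else 1) ^ μ v) = (-1) ^ rowCount μ i := by
    rw [← hsum, ← Finset.prod_pow_eq_pow_sum]
    refine Finset.prod_congr rfl fun v _ => ?_
    split_ifs <;> simp
  rw [rowFlip, coeff_linSubst_diagonal, hprod]

/-! ## Parity slices -/

open Classical in
/-- PARITY SLICE `Q_{R,S} f`: keep the monomials of `f` whose row degrees are ODD exactly on `R ∩ S` among the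
rows of `R` (no condition on the rows outside `R`). [cite: LandsbergRessayre2017, Thm 2.8] -/
def paritySlice (m : ℕ) (R S : Finset (Fin m)) (f : MvPolynomial (Fin m × Fin m) ℂ) :
    MvPolynomial (Fin m × Fin m) ℂ :=
  ∑ μ ∈ f.support.filter (fun μ => ∀ i ∈ R, (Odd (rowCount μ i) ↔ i ∈ S)), monomial μ (coeff μ f)

/-- Coefficients of a slice. [folklore] -/
theorem coeff_paritySlice (R S : Finset (Fin m)) (f : MvPolynomial (Fin m × Fin m) ℂ)
    (μ : Fin m × Fin m →₀ ℕ) :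
    coeff μ (paritySlice m R S f) = if (∀ i ∈ R, (Odd (rowCount μ i) ↔ i ∈ S)) then coeff μ f else 0 := by
  unfold paritySlice
  rw [coeff_sum]
  simp only [coeff_monomial, Finset.sum_ite_eq']
  by_cases hP : ∀ i ∈ R, (Odd (rowCount μ i) ↔ i ∈ S)
  · rw [if_pos hP]
    by_cases h0 : coeff μ f = 0
    · rw [h0]
      split_ifs <;> rfl
    · exact if_pos (Finset.mem_filter.2 ⟨mem_support_iff.2 h0, hP⟩)
  · rw [if_neg hP]
    exact if_neg fun h => hP (Finset.mem_filter.1 h).2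

/-- Coefficients of a slice, kept case. [folklore] -/
theorem coeff_paritySlice_of_pos (R S : Finset (Fin m)) (f : MvPolynomial (Fin m × Fin m) ℂ)
    {μ : Fin m × Fin m →₀ ℕ} (h : ∀ i ∈ R, (Odd (rowCount μ i) ↔ i ∈ S)) :
    coeff μ (paritySlice m R S f) = coeff μ f := by
  rw [coeff_paritySlice, if_pos h]

/-- Coefficients of a slice, killed case. [folklore] -/
theorem coeff_paritySlice_of_neg (R S : Finset (Fin m)) (f : MvPolynomial (Fin m × Fin m) ℂ)
    {μ : Fin m × Fin m →₀ ℕ} (h : ¬ ∀ i ∈ R, (Odd (rowCount μ i) ↔ i ∈ S)) :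
    coeff μ (paritySlice m R S f) = 0 := by
  rw [coeff_paritySlice, if_neg h]

/-- No row condition: the slice is everything. [folklore] -/
theorem paritySlice_empty (S : Finset (Fin m)) (f : MvPolynomial (Fin m × Fin m) ℂ) :
    paritySlice m ∅ S f = f := by
  ext μ
  exact coeff_paritySlice_of_pos ∅ S f fun i hi => absurd hi (by simp)

/-- ONE MORE ROW: `Q_{R ∪ {i}, S} = ½ (1 ∓ flip_i) ∘ Q_{R,S}` (minus iff `i ∈ S`). [cite: LandsbergRessayre2017, Thm 2.8] -/
theorem paritySlice_insert (R S : Finset (Fin m)) (i : Fin m) (f : MvPolynomial (Fin m × Fin m) ℂ) :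
    paritySlice m (insert i R) S f =
      if i ∈ S then (1 / 2 : ℂ) • (paritySlice m R S f - linSubst (Fin m × Fin m) ℂ (rowFlip m i) (paritySlice m R S f))
      else (1 / 2 : ℂ) • (paritySlice m R S f + linSubst (Fin m × Fin m) ℂ (rowFlip m i) (paritySlice m R S f)) := by
  classical
  ext μ
  have key : ∀ ε : ℂ, (ε = 1 ∨ ε = -1) →
      coeff μ ((1 / 2 : ℂ) • (paritySlice m R S f + ε • linSubst (Fin m × Fin m) ℂ (rowFlip m i)
        (paritySlice m R S f))) =
      if ((-1 : ℂ) ^ rowCount μ i = ε ∧ ∀ j ∈ R, (Odd (rowCount μ j) ↔ j ∈ S)) then coeff μ f else 0 := by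
    intro ε hε
    rw [coeff_smul, coeff_add, coeff_smul, coeff_linSubst_rowFlip, coeff_paritySlice, smul_eq_mul, smul_eq_mul]
    by_cases hR : ∀ j ∈ R, (Odd (rowCount μ j) ↔ j ∈ S)
    · rw [if_pos hR]
      rcases Nat.even_or_odd (rowCount μ i) with hr | hr
      · rw [hr.neg_one_pow]
        rcases hε with rfl | rfl
        · rw [if_pos ⟨rfl, hR⟩]; ring
        · rw [if_neg fun h => by norm_num at h]; ring
      · rw [hr.neg_one_pow]
        rcases hε with rfl | rfl
        · rw [if_neg fun h => by norm_num at h]; ring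
        · rw [if_pos ⟨rfl, hR⟩]; ring
    · rw [if_neg hR, if_neg fun h => hR h.2]; ring
  by_cases hi : i ∈ S
  · rw [if_pos hi, coeff_paritySlice, sub_eq_add_neg,
      ← neg_one_smul ℂ (linSubst (Fin m × Fin m) ℂ (rowFlip m i) (paritySlice m R S f)), key (-1) (Or.inr rfl)]
    refine if_congr ?_ rfl rfl
    rw [Finset.forall_mem_insert]
    refine and_congr_left' ?_
    rcases Nat.even_or_odd (rowCount μ i) with hr | hr
    · rw [hr.neg_one_pow]
      exact ⟨fun h => absurd (h.2 hi) (Nat.not_odd_iff_even.2 hr), fun h => by norm_num at h⟩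
    · rw [hr.neg_one_pow]
      exact ⟨fun _ => rfl, fun _ => iff_of_true hr hi⟩
  · rw [if_neg hi, coeff_paritySlice, ← one_smul ℂ (linSubst (Fin m × Fin m) ℂ (rowFlip m i) (paritySlice m R S f)),
      key 1 (Or.inl rfl)]
    refine if_congr ?_ rfl rfl
    rw [Finset.forall_mem_insert]
    refine and_congr_left' ?_
    rcases Nat.even_or_odd (rowCount μ i) with hr | hr
    · rw [hr.neg_one_pow]
      exact ⟨fun _ => rfl, fun _ => iff_of_false (Nat.not_odd_iff_even.2 hr) hi⟩
    · rw [hr.neg_one_pow]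
      exact ⟨fun h => absurd (h.1 hr) hi, fun h => by norm_num at h⟩

/-- A linear map that sends the generators into the span preserves the span. [folklore] -/
theorem map_mem_span_of_forall {s : Finset (MvPolynomial (Fin m × Fin m) ℂ)}
    (L : MvPolynomial (Fin m × Fin m) ℂ →ₗ[ℂ] MvPolynomial (Fin m × Fin m) ℂ)
    (hL : ∀ p ∈ s, L p ∈ Submodule.span ℂ (s : Set (MvPolynomial (Fin m × Fin m) ℂ)))
    {f : MvPolynomial (Fin m × Fin m) ℂ} (hf : f ∈ Submodule.span ℂ (s : Set (MvPolynomial (Fin m × Fin m) ℂ))) :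
    L f ∈ Submodule.span ℂ (s : Set (MvPolynomial (Fin m × Fin m) ℂ)) := by
  have h : Submodule.span ℂ (s : Set (MvPolynomial (Fin m × Fin m) ℂ)) ≤
      (Submodule.span ℂ (s : Set (MvPolynomial (Fin m × Fin m) ℂ))).comap L :=
    Submodule.span_le.2 fun p hp => Submodule.mem_comap.2 (hL p (Finset.mem_coe.1 hp))
  exact Submodule.mem_comap.1 (h hf)

/-- THE PROJECTOR LEMMA: a subspace spanned by a flip-stable finite set is stable under every parity slice.
[cite: LandsbergRessayre2017, Thm 2.8] -/
theorem paritySlice_mem_span {s : Finset (MvPolynomial (Fin m × Fin m) ℂ)}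
    (hflip : ∀ i : Fin m, ∀ p ∈ s, linSubst (Fin m × Fin m) ℂ (rowFlip m i) p ∈
      Submodule.span ℂ (s : Set (MvPolynomial (Fin m × Fin m) ℂ)))
    {f : MvPolynomial (Fin m × Fin m) ℂ} (hf : f ∈ Submodule.span ℂ (s : Set (MvPolynomial (Fin m × Fin m) ℂ)))
    (R S : Finset (Fin m)) :
    paritySlice m R S f ∈ Submodule.span ℂ (s : Set (MvPolynomial (Fin m × Fin m) ℂ)) := by
  induction R using Finset.induction_on with
  | empty => rwa [paritySlice_empty]
  | insert i R _ ih =>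
    have hT : linSubst (Fin m × Fin m) ℂ (rowFlip m i) (paritySlice m R S f) ∈
        Submodule.span ℂ (s : Set (MvPolynomial (Fin m × Fin m) ℂ)) :=
      map_mem_span_of_forall (linSubst (Fin m × Fin m) ℂ (rowFlip m i)).toLinearMap (hflip i) ih
    rw [paritySlice_insert]
    split_ifs
    · exact Submodule.smul_mem _ _ (Submodule.sub_mem _ ih hT)
    · exact Submodule.smul_mem _ _ (Submodule.add_mem _ ih hT)

/-! ## Row permutations -/

/-- Renaming by a row permutation is injective on variables. [folklore] -/
theorem rowMap_injective (σ : Equiv.Perm (Fin m)) :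
    Function.Injective (fun v : Fin m × Fin m => (σ v.1, v.2)) := by
  intro v w h
  simp only [Prod.mk.injEq] at h
  exact Prod.ext (σ.injective h.1) h.2

/-- Row permutations move row degrees. [folklore] -/
theorem rowCount_mapDomain_rowPerm (σ : Equiv.Perm (Fin m)) (μ : Fin m × Fin m →₀ ℕ) (i : Fin m) :
    rowCount (Finsupp.mapDomain (fun v : Fin m × Fin m => (σ v.1, v.2)) μ) (σ i) = rowCount μ i := by
  unfold rowCount
  refine Finset.sum_congr rfl fun c _ => ?_
  have h : ((σ i, c) : Fin m × Fin m) = (fun v : Fin m × Fin m => (σ v.1, v.2)) (i, c) := rfl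
  rw [h, Finsupp.mapDomain_apply (rowMap_injective σ)]

/-- COVARIANCE: a row permutation carries the full slice of class `S` to the full slice of class `σ S`.
[cite: LandsbergRessayre2017, Thm 2.8] -/
theorem paritySlice_rename (σ : Equiv.Perm (Fin m)) (S : Finset (Fin m)) (f : MvPolynomial (Fin m × Fin m) ℂ) :
    paritySlice m Finset.univ (S.map σ.toEmbedding) (rename (fun v : Fin m × Fin m => (σ v.1, v.2)) f) =
      rename (fun v : Fin m × Fin m => (σ v.1, v.2)) (paritySlice m Finset.univ S f) := by
  ext μ
  have hcomp : ((fun v : Fin m × Fin m => (σ v.1, v.2)) ∘ fun v : Fin m × Fin m => (σ.symm v.1, v.2)) = id := by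
    funext v
    simp
  have hgh : Finsupp.mapDomain (fun v : Fin m × Fin m => (σ v.1, v.2))
      (Finsupp.mapDomain (fun v : Fin m × Fin m => (σ.symm v.1, v.2)) μ) = μ := by
    rw [← Finsupp.mapDomain_comp, hcomp, Finsupp.mapDomain_id]
  obtain ⟨ν, rfl⟩ : ∃ ν, μ = Finsupp.mapDomain (fun v : Fin m × Fin m => (σ v.1, v.2)) ν := ⟨_, hgh.symm⟩
  rw [coeff_rename_mapDomain _ (rowMap_injective σ), coeff_paritySlice, coeff_paritySlice,
    coeff_rename_mapDomain _ (rowMap_injective σ)]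
  have key : (∀ i ∈ (Finset.univ : Finset (Fin m)),
      (Odd (rowCount (Finsupp.mapDomain (fun v : Fin m × Fin m => (σ v.1, v.2)) ν) i) ↔
        i ∈ S.map σ.toEmbedding)) ↔
      ∀ i ∈ (Finset.univ : Finset (Fin m)), (Odd (rowCount ν i) ↔ i ∈ S) := by
    simp only [Finset.mem_univ, true_implies, Finset.mem_map_equiv]
    constructor
    · intro H i
      have h1 := H (σ i)
      rwa [rowCount_mapDomain_rowPerm, Equiv.symm_apply_apply] at h1
    · intro H i
      have h1 := rowCount_mapDomain_rowPerm σ ν (σ.symm i)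
      rw [Equiv.apply_symm_apply] at h1
      rw [h1]
      exact H (σ.symm i)
  by_cases hB : ∀ i ∈ (Finset.univ : Finset (Fin m)), (Odd (rowCount ν i) ↔ i ∈ S)
  · rw [if_pos hB, if_pos (key.2 hB)]
  · rw [if_neg hB, if_neg (mt key.1 hB)]

/-! ## The square-free witness -/

/-- SQUARE-FREE WITNESS: if `per_m` lies in the ideal of `s`, some generator has a monomial taking at most one
variable from each row (else every generator, hence the ideal, lies in the monomial ideal of same-row pairs
`x_{ij} x_{ij'}`, which misses every monomial of `per_m ≠ 0`). [cite: LandsbergRessayre2017, Thm 2.8] -/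
theorem exists_rowCount_le_one {s : Finset (MvPolynomial (Fin m × Fin m) ℂ)}
    (hper : perPoly (Fin m) ℂ ∈ Ideal.span (s : Set (MvPolynomial (Fin m × Fin m) ℂ))) :
    ∃ p ∈ s, ∃ μ ∈ p.support, ∀ i : Fin m, rowCount μ i ≤ 1 := by
  by_contra hcon
  simp only [not_exists, not_and, not_forall, not_le] at hcon
  have hsJ : Ideal.span (s : Set (MvPolynomial (Fin m × Fin m) ℂ)) ≤
      Ideal.span ((fun β => monomial β (1 : ℂ)) '' {β : Fin m × Fin m →₀ ℕ | ∃ i, 1 < rowCount β i}) := by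
    refine Ideal.span_le.2 fun p hp => SetLike.mem_coe.2 (mem_ideal_span_monomial_image.2 fun μ hμ => ?_)
    obtain ⟨i, hi⟩ := hcon p (Finset.mem_coe.1 hp) μ hμ
    exact ⟨μ, ⟨i, hi⟩, le_rfl⟩
  have hperJ := mem_ideal_span_monomial_image.1 (hsJ hper) (permMonomial 1)
    (by rw [mem_support_iff, coeff_permMonomial_perPoly]; exact one_ne_zero)
  obtain ⟨β, ⟨i, hi⟩, hle⟩ := hperJ
  have h1 : rowCount β i ≤ 1 :=
    calc rowCount β i ≤ rowCount (permMonomial (1 : Equiv.Perm (Fin m))) i := by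
          unfold rowCount; exact Finset.sum_le_sum fun c _ => Finsupp.le_def.1 hle (i, c)
      _ = 1 := rowCount_permMonomial 1 i
  omega

/-- The rows met by such a monomial of a degree-`d` form number exactly `d`. [folklore] -/
theorem card_filter_rowCount_eq_one {p : MvPolynomial (Fin m × Fin m) ℂ} {d : ℕ} (hp : p.IsHomogeneous d)
    {μ : Fin m × Fin m →₀ ℕ} (hμ : μ ∈ p.support) (h1 : ∀ i : Fin m, rowCount μ i ≤ 1) :
    (Finset.univ.filter fun i : Fin m => rowCount μ i = 1).card = d := by
  have hdeg : μ.degree = d := by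
    by_contra hne
    exact (mem_support_iff.1 hμ) (hp.coeff_eq_zero hne)
  rw [Finsupp.degree_eq_sum, Fintype.sum_prod_type] at hdeg
  rw [Finset.card_filter, ← hdeg]
  refine Finset.sum_congr rfl fun i _ => ?_
  have h2 : rowCount μ i = ∑ c, μ (i, c) := rfl
  obtain h | h : rowCount μ i = 0 ∨ rowCount μ i = 1 := by have := h1 i; omega
  · rw [if_neg (by omega), ← h2, h]
  · rw [if_pos h, ← h2, h]

/-- A full slice keeping a monomial of `f` is non-zero. [folklore] -/
theorem paritySlice_univ_ne_zero {S : Finset (Fin m)} {f : MvPolynomial (Fin m × Fin m) ℂ}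
    {μ : Fin m × Fin m →₀ ℕ} (hμ : μ ∈ f.support) (hS : ∀ i : Fin m, (Odd (rowCount μ i) ↔ i ∈ S)) :
    paritySlice m Finset.univ S f ≠ 0 := by
  intro h0
  apply mem_support_iff.1 hμ
  rw [← coeff_paritySlice_of_pos Finset.univ S f fun i _ => hS i, h0, coeff_zero]

/-- DISJOINT SUPPORTS: non-zero vectors lying in pairwise distinct full parity classes are linearly independent.
[folklore] -/
theorem linearIndependent_of_paritySlice {ι : Type*} (S : ι → Finset (Fin m)) (hS : Function.Injective S)
    (w : ι → MvPolynomial (Fin m × Fin m) ℂ) (hw : ∀ a, paritySlice m Finset.univ (S a) (w a) = w a)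
    (hne : ∀ a, w a ≠ 0) : LinearIndependent ℂ w := by
  rw [linearIndependent_iff']
  intro t g hrel b hb
  obtain ⟨μ, hμ⟩ := ne_zero_iff.1 (hne b)
  have hclass : ∀ i ∈ (Finset.univ : Finset (Fin m)), (Odd (rowCount μ i) ↔ i ∈ S b) := by
    by_contra h
    apply hμ
    rw [← hw b, coeff_paritySlice_of_neg _ _ _ h]
  have hcoeff : ∀ a, a ≠ b → coeff μ (w a) = 0 := by
    intro a hab
    rw [← hw a]
    refine coeff_paritySlice_of_neg _ _ _ fun h => hab (hS ?_)
    ext i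
    exact (h i (Finset.mem_univ i)).symm.trans (hclass i (Finset.mem_univ i))
  have h := congr_arg (coeff μ) hrel
  rw [coeff_sum, coeff_zero, Finset.sum_eq_single b (fun a _ hab => by
    rw [coeff_smul, hcoeff a hab, smul_zero]) (fun hbt => absurd hb hbt), coeff_smul, smul_eq_mul] at h
  exact (mul_eq_zero.1 h).resolve_right hμ

/-! ## The count -/

/-- ★ THE PARITY-CUT COUNT.  A finite set `s` of degree-`d` forms whose span is stable under the row sign flips
and the row permutations and whose ideal contains `per_m` has at least `C(m, d)` elements: one independent
vector of `span s` in each parity class `S`, `|S| = d`. [cite: LandsbergRessayre2017, Thm 2.8] -/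
theorem choose_le_card_of_stable {d : ℕ} {s : Finset (MvPolynomial (Fin m × Fin m) ℂ)}
    (hhom : ∀ p ∈ s, p.IsHomogeneous d)
    (hflip : ∀ i : Fin m, ∀ p ∈ s, linSubst (Fin m × Fin m) ℂ (rowFlip m i) p ∈
      Submodule.span ℂ (s : Set (MvPolynomial (Fin m × Fin m) ℂ)))
    (hperm : ∀ σ : Equiv.Perm (Fin m), ∀ p ∈ s, rename (fun v : Fin m × Fin m => (σ v.1, v.2)) p ∈
      Submodule.span ℂ (s : Set (MvPolynomial (Fin m × Fin m) ℂ)))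
    (hper : perPoly (Fin m) ℂ ∈ Ideal.span (s : Set (MvPolynomial (Fin m × Fin m) ℂ))) :
    m.choose d ≤ s.card := by
  classical
  obtain ⟨p, hp, μ, hμ, h1⟩ := exists_rowCount_le_one hper
  obtain ⟨S₀, hS₀⟩ : ∃ S₀ : Finset (Fin m), S₀ = Finset.univ.filter fun i : Fin m => rowCount μ i = 1 :=
    ⟨_, rfl⟩
  have hcard : S₀.card = d := by
    rw [hS₀]
    exact card_filter_rowCount_eq_one (hhom p hp) hμ h1
  have hclass : ∀ i : Fin m, (Odd (rowCount μ i) ↔ i ∈ S₀) := by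
    intro i
    rw [hS₀, Finset.mem_filter]
    obtain h | h : rowCount μ i = 0 ∨ rowCount μ i = 1 := by have := h1 i; omega
    · rw [h]
      exact iff_of_false Nat.not_odd_zero fun ha => zero_ne_one ha.2
    · rw [h]
      exact iff_of_true odd_one ⟨Finset.mem_univ i, rfl⟩
  have hw₀V : paritySlice m Finset.univ S₀ p ∈ Submodule.span ℂ (s : Set (MvPolynomial (Fin m × Fin m) ℂ)) :=
    paritySlice_mem_span hflip (Submodule.subset_span (Finset.mem_coe.2 hp)) _ _
  have hw₀ne : paritySlice m Finset.univ S₀ p ≠ 0 := paritySlice_univ_ne_zero hμ hclass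
  have hidem : paritySlice m Finset.univ S₀ (paritySlice m Finset.univ S₀ p) = paritySlice m Finset.univ S₀ p := by
    ext ν
    by_cases h : ∀ i ∈ (Finset.univ : Finset (Fin m)), (Odd (rowCount ν i) ↔ i ∈ S₀)
    · rw [coeff_paritySlice_of_pos _ _ _ h]
    · rw [coeff_paritySlice_of_neg _ _ _ h, coeff_paritySlice_of_neg _ _ _ h]
  have hσ : ∀ T : {T : Finset (Fin m) // T.card = d}, ∃ σ : Equiv.Perm (Fin m),
      S₀.map σ.toEmbedding = T.1 := by
    intro T
    obtain ⟨e⟩ : Nonempty ({x // x ∈ S₀} ≃ {x // x ∈ T.1}) :=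
      ⟨Fintype.equivOfCardEq (by rw [Fintype.card_coe, Fintype.card_coe, hcard, T.2])⟩
    refine ⟨e.extendSubtype, Finset.eq_of_subset_of_card_le (fun b hb => ?_)
      (le_of_eq (by rw [Finset.card_map, hcard, T.2]))⟩
    obtain ⟨a, ha, rfl⟩ := Finset.mem_map.1 hb
    exact e.extendSubtype_mem a ha
  choose σ hσ using hσ
  obtain ⟨w, hwdef⟩ : ∃ w : {T : Finset (Fin m) // T.card = d} → MvPolynomial (Fin m × Fin m) ℂ,
      ∀ T, w T = rename (fun v : Fin m × Fin m => (σ T v.1, v.2)) (paritySlice m Finset.univ S₀ p) :=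
    ⟨_, fun T => rfl⟩
  have hwV : ∀ T, w T ∈ Submodule.span ℂ (s : Set (MvPolynomial (Fin m × Fin m) ℂ)) := fun T => by
    rw [hwdef T]
    exact map_mem_span_of_forall
      (rename (fun v : Fin m × Fin m => (σ T v.1, v.2))).toLinearMap (hperm (σ T)) hw₀V
  have hw : ∀ T, paritySlice m Finset.univ T.1 (w T) = w T := by
    intro T
    rw [hwdef T]
    conv_lhs => rw [← hσ T]
    rw [paritySlice_rename, hidem]
  have hne : ∀ T, w T ≠ 0 := by
    intro T h0
    apply hw₀ne
    rw [hwdef T] at h0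
    exact rename_injective _ (rowMap_injective (σ T)) (by rw [map_zero]; exact h0)
  have hli : LinearIndependent ℂ w :=
    linearIndependent_of_paritySlice (fun T => T.1) Subtype.val_injective w hw hne
  have hli' : LinearIndependent ℂ (fun T => (⟨w T, hwV T⟩ :
      Submodule.span ℂ (s : Set (MvPolynomial (Fin m × Fin m) ℂ)))) :=
    LinearIndependent.of_comp (Submodule.span ℂ (s : Set (MvPolynomial (Fin m × Fin m) ℂ))).subtype hli
  calc m.choose d = Fintype.card {T : Finset (Fin m) // T.card = d} := by
        rw [Fintype.card_finset_len, Fintype.card_fin]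
    _ ≤ Module.finrank ℂ (Submodule.span ℂ (s : Set (MvPolynomial (Fin m × Fin m) ℂ))) :=
        hli'.fintype_card_le_finrank
    _ ≤ s.card := finrank_span_finset_le_card s

end Summit.ValiantsHypothesis.ValiantsHypothesis.Theorems.EquivariantDialParityCut

end
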